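import Mathlib
import Literature.NumberTheory.Automorphic.LanglandsTetrahedral

/-!
# Icosahedral quadratic descent — Galois-side preliminaries, I: the scalar lemma

If `ρ : G → GL₂(ℂ)` has projective image `≅ A₅` (a perfect group), then every coset of the
commutator subgroup of `G` contains an element `h` with `ρ(h)` scalar.
-/

set_option linter.dupNamespace false

noncomputable section

open scoped MatrixGroups commutatorElement

namespace Summit.Langlands.Langlands.Theorems.IcosahedralQuadraticDescent

/-- `A₅` is perfect: its commutator subgroup is everything (`A₅` is simple and non-abelian).
[folklore] -/
theorem commutator_alternatingGroup_five_eq_top :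
    commutator (alternatingGroup (Fin 5)) = ⊤ := by
  rcases (Subgroup.commutator_normal (⊤ : Subgroup (alternatingGroup (Fin 5)))
    (⊤ : Subgroup (alternatingGroup (Fin 5)))).eq_bot_or_eq_top with h | h
  · exfalso
    -- two non-commuting `3`-cycles
    let x0 : Equiv.Perm (Fin 5) := ⟨![1, 2, 0, 3, 4], ![2, 0, 1, 3, 4], by decide, by decide⟩
    let y0 : Equiv.Perm (Fin 5) := ⟨![0, 2, 3, 1, 4], ![0, 3, 1, 2, 4], by decide, by decide⟩
    have hx0 : x0 ∈ alternatingGroup (Fin 5) := by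
      rw [Equiv.Perm.mem_alternatingGroup]; decide
    have hy0 : y0 ∈ alternatingGroup (Fin 5) := by
      rw [Equiv.Perm.mem_alternatingGroup]; decide
    let x : alternatingGroup (Fin 5) := ⟨x0, hx0⟩
    let y : alternatingGroup (Fin 5) := ⟨y0, hy0⟩
    have hxy : (⁅x, y⁆ : alternatingGroup (Fin 5)) ∈ commutator (alternatingGroup (Fin 5)) := by
      rw [commutator_eq_closure]
      exact Subgroup.subset_closure ⟨x, y, rfl⟩
    rw [_root_.commutator, h, Subgroup.mem_bot] at hxy
    have h2 := congrArg (fun g : alternatingGroup (Fin 5) => ((g : Equiv.Perm (Fin 5)) 0)) hxy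
    simp only [commutatorElement_def, Subgroup.coe_mul, InvMemClass.coe_inv, OneMemClass.coe_one,
      Equiv.Perm.coe_one, id_eq, x, y, x0, y0] at h2
    exact absurd h2 (by decide)
  · exact h

variable {G : Type*} [Group G]

/-- A group isomorphic to `A₅` is perfect. [folklore] -/
theorem commutator_eq_top_of_mulEquiv_alternatingGroup_five {P : Type*} [Group P]
    (e : P ≃* alternatingGroup (Fin 5)) : commutator P = ⊤ := by
  have h1 : Subgroup.map e.symm.toMonoidHom (commutator (alternatingGroup (Fin 5))) = commutator P := by
    rw [_root_.commutator, _root_.commutator, Subgroup.map_commutator,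
      ← MonoidHom.range_eq_map, MonoidHom.range_eq_top.mpr e.symm.surjective]
  rw [← h1, commutator_alternatingGroup_five_eq_top, ← MonoidHom.range_eq_map,
    MonoidHom.range_eq_top.mpr e.symm.surjective]

/-- **The scalar lemma.**  If `ρ : G → GL₂(ℂ)` has projective image isomorphic to `A₅`, then for
every `g ∈ G` there is `y` in the commutator subgroup of `G` and a unit `u` with
`ρ (y⁻¹ g) = u · 1`: the projective image is perfect, so `\bar ρ` maps the commutator subgroup
onto it. [folklore] -/
theorem exists_mem_commutator_apply_eq_scalar (ρ : G →* GL (Fin 2) ℂ)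
    (e : (Matrix.ProjGenLinGroup.mk.comp ρ).range ≃* alternatingGroup (Fin 5)) (g : G) :
    ∃ y ∈ commutator G, ∃ u : ℂˣ, ρ (y⁻¹ * g) = Matrix.GeneralLinearGroup.scalar (Fin 2) u := by
  set φ := (Matrix.ProjGenLinGroup.mk.comp ρ).rangeRestrict with hφ
  have hsurj : Function.Surjective φ := MonoidHom.rangeRestrict_surjective _
  have htop : commutator (Matrix.ProjGenLinGroup.mk.comp ρ).range = ⊤ :=
    commutator_eq_top_of_mulEquiv_alternatingGroup_five e
  have hmap : Subgroup.map φ (commutator G) = ⊤ := by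
    rw [_root_.commutator, Subgroup.map_commutator, ← MonoidHom.range_eq_map,
      MonoidHom.range_eq_top.mpr hsurj, ← _root_.commutator, htop]
  have hg : φ g ∈ Subgroup.map φ (commutator G) := by rw [hmap]; exact Subgroup.mem_top _
  obtain ⟨y, hy, hyg⟩ := Subgroup.mem_map.mp hg
  have hmk : Matrix.ProjGenLinGroup.mk (ρ y) = Matrix.ProjGenLinGroup.mk (ρ g) := by
    have := congrArg Subtype.val hyg
    simpa [hφ] using this
  obtain ⟨u, hu⟩ := Matrix.ProjGenLinGroup.mk_eq_mk_iff.mp hmk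
  refine ⟨y, hy, u, ?_⟩
  rw [map_mul, map_inv, ← hu, inv_mul_cancel_left]

/-- The commutator subgroup lies in every subgroup of index `2`. [folklore] -/
theorem commutator_le_of_index_eq_two (H : Subgroup G) (hH : H.index = 2) : commutator G ≤ H := by
  have h := Abelianization.commutator_subset_ker
    (Literature.NumberTheory.Automorphic.signCharOfIndexTwo (R := ℂ) H hH)
  rwa [Literature.NumberTheory.Automorphic.ker_signCharOfIndexTwo] at h

end Summit.Langlands.Langlands.Theorems.IcosahedralQuadraticDescent

end
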